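import Literature.NumberTheory.EllipticCurves.LiXu2026.AnticyclotomicMordellWeilRankGrowth
import Literature.NumberTheory.EllipticCurves.WeilPairingRootsOfUnityHolds
import Literature.NumberTheory.EllipticCurves.TorsionCardinality
import Literature.NumberTheory.EllipticCurves.MordellWeilProofs
import Literature.NumberTheory.GaloisRepresentations.AbsGaloisGroupProofs
import Literature.NumberTheory.GaloisRepresentations.AbsGaloisOuterConj
import Literature.NumberTheory.GaloisRepresentations.ArtinFormalismInductionProofs
import Mathlib.RingTheory.RootsOfUnity.Minpoly
import HarnessLib

/-!
# Li–Xu 2026, Proposition 5.2 for an elliptic curve — the torsion of `E/ℚ` along the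
# anticyclotomic `ℤ_p`-tower of an imaginary quadratic field is bounded: DISCHARGED

Topic `NumberTheory/EllipticCurves`, sub-directory `LiXu2026` (namespace = path). `Proofs` file:
THEOREMS ONLY (no definition, no named fact, no instance; D-0026); net Literature debt `−1`.

H. Li, R. Xu, *Asymptotics of Mordell–Weil ranks of CM abelian varieties over anticyclotomic
towers*, J. Number Theory (2026) = arXiv:2502.12648, **Proposition 5.2**: "Let `A/ℚ` be an
abelian variety over `ℚ`, then `A(K_∞^{ac})_{tors}` is finite" (`K` imaginary quadratic, `p` odd,
`K_∞^{ac}` the anticyclotomic `ℤ_p`-extension). The tree's transcription for `A = E` an elliptic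
curve is the named fact `Literature.NumberTheory.EllipticCurves.LiXu2026.prop52_torsionOrder_layer_bounded`
(`AnticyclotomicMordellWeilRankGrowth.lean`): for `W/ℚ` elliptic, `K` imaginary quadratic, `p ≠ 2`
and `κ : ZpExtension K p` anticyclotomic, the torsion orders `#E(K_n)_{tors}`
(`WeierstrassCurve.torsionOrder` of the base change to the layer `κ.layer n ⊂ K̄`) are bounded in
`n`. This file proves it: `prop52_torsionOrder_layer_bounded_holds`.

## The printed proof and the road taken here

PRINT (Lemma 5.1 + Prop. 5.2, arXiv §5): choose two rational primes `q₁ ≠ q₂`, both `≠ p`, inert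
in `K` and of good reduction; an inert prime splits completely in `K_∞^{ac}` (Lemma 5.1, class
field theory / Brink 2007 §III), so every layer `K_n` has residue field `𝔽_{q_i²}` above `q_i`, and
`E(K_n)[m] ↪ Ẽ(𝔽_{q_i²})` for `q_i ∤ m` bounds the torsion by `#Ẽ(𝔽_{q₁²}) · #Ẽ(𝔽_{q₂²})`.
The tree has the reduction step (`injective_reduceHom`) but NOT Lemma 5.1 (the decomposition of
inert primes in `K_∞^{ac}/K`: no bridge from `GreenbergSelmer.decomp` to residue degrees in the
finite layers). DEVIATION (a genuinely shorter road in the tree, recorded here as required): the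
statement is proved by pure Galois theory from the two inputs the tree DOES have —

* the **anticyclotomic relation** `κ(ρ σ ρ⁻¹) = κ(σ)⁻¹` for `ρ ∈ Γ_ℚ ∖ Γ_K` (the definition
  `ZpExtension.IsAnticyclotomic`, with the outer conjugation `absGaloisOuterConjFun ℚ K ρ` of
  `AbsGaloisOuterConj.lean`), and
* the **Weil pairing corollary** `E[d] ⊂ E(F) ⟹ μ_d ⊂ F` (Silverman AEC III.8.1.1, the tree's
  PROVED `WeierstrassCurve.exists_isPrimitiveRoot_of_card_torsionBy_eq_sq_holds`) —

as follows. (1) DESCENT LEMMA (`eq_one_of_isAnticyclotomic`): for `p` odd, a multiplicative map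
`ψ : Γ_K → M` into a monoid which factors through `κ` and is invariant under the outer
`ρ`-conjugation is trivial (halve `κ σ` in `ℤ_p`: `σ ≡ σ_h²`, `κ(σ_h · ρσ_hρ⁻¹) = 1`, so
`ψ(σ_h)² = 1 = ψ(σ)`). (2) GROUP THEORY (`exists_index_sq_le_card_torsionBy`): `T = E(K_n)_{tors}`
embeds in `E(K̄)[e]` (`e` = exponent of `T`), so `#T ∣ e²`; with `P ∈ T` of order `e` and
`d = [T : ⟨P⟩]` one has `d ∣ e`, `dT ⊆ ⟨dP⟩` (cyclic, of order `e/d`) and hence `#E(K_n)[d] = d²`.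
(3) The cyclic group `⟨dP⟩ ⊂ E(K̄)` is stable under `Γ_K` and under the transported conjugation
`g_ρ = ι ∘ ρ ∘ ι⁻¹` of `K̄` (`ι : ℚ̄ ≅ K̄` the tree's `absClosureEquiv ℚ K`; `g_ρ` preserves
`K_n`, `conj_apply_mem_layer`), `Γ_K` acts on it through `Gal(K_n/K)`, and any two
endomorphisms of a cyclic group commute; so by (1) `Γ_K` acts trivially: `dP ∈ E(K)`, whence
`e/d ≤ t := #E(K)_{tors}` (finite, `WeierstrassCurve.finite_torsion_point`). (4) `#E(K_n)[d] = d²`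
gives a primitive `d`-th root of unity `ζ ∈ K_n` (Weil pairing); the cyclotomic character
`σ ↦ (σζ = ζ^k)` (Mathlib `IsPrimitiveRoot.autToPow`) is conjugation-invariant and factors
through `Gal(K_n/K)`, so by (1) `ζ ∈ K`, whence `d ∣ w := #μ(K)` (`NumberField.Units.torsionOrder`).
Altogether `#E(K_n)_{tors} = e·d = (e/d)·d² ≤ w²·t`, a bound independent of `n`.

HONEST FRAMING: elementary Galois theory on top of the tree's `ZpExtension` / absolute-Galois-group
API and the Weil pairing; nothing about `L`-functions or ranks. The statement proved is exactly the
registered named fact (Li–Xu Prop. 5.2 for `A = E`), by a different (shorter, in this tree) proof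
than the printed one.

## References

* [LiXu2026] H. Li, R. Xu, J. Number Theory (2026), doi:10.1016/j.jnt.2026.06.001 =
  arXiv:2502.12648, Prop. 5.2 and Lemma 5.1.
* [SilvermanAEC2009] J. H. Silverman, *The Arithmetic of Elliptic Curves*, 2nd ed., GTM 106,
  Cor. III.6.4(b) (`#E[m] = m²`), Cor. III.8.1.1 (Weil pairing), Cor. VIII.6.7.1 (finite torsion).
* [Washington1997] L. C. Washington, *Introduction to Cyclotomic Fields*, §13.1 (`ℤ_p`-extensions).

## Mathlib / tree search

Tree, by name: `ZpExtension.IsAnticyclotomic`, `ZpExtension.layer`, `mem_layerSubgroup`,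
`kerSubgroup_le_layerSubgroup`, `absGaloisOuterConjFun`, `absGaloisRestrict_absGaloisOuterConjFun`,
`absGaloisRestrict_apply_smul`, `absClosureEquiv`, `absGaloisRestrict_injective`,
`index_range_absGaloisRestrict_eq_finrank`, `WeierstrassCurve.card_torsionBy_eq_sq`,
`WeierstrassCurve.exists_isPrimitiveRoot_of_card_torsionBy_eq_sq_holds`,
`WeierstrassCurve.finite_torsion_point`. Mathlib: `IsPrimitiveRoot.autToPow`,
`InfiniteGalois.mem_range_algebraMap_iff_fixed`, `WeierstrassCurve.Affine.Point.map`,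
`NumberField.Units.torsionOrder`, `AddMonoid.exists_addOrderOf_eq_exponent`.
`rg 'prop52_torsionOrder_layer_bounded_holds'` over `lean/`: no prior discharge.
-/

noncomputable section

open scoped Classical
open Field NumberField

namespace Literature.NumberTheory.EllipticCurves.LiXu2026

open Literature.NumberTheory.GaloisRepresentations ZpExtension

/-! ### §1 The anticyclotomic descent lemma -/

section Descent

variable {K : Type} [Field K] {p : ℕ} [Fact p.Prime]

/-- `2` is invertible in `ℤ_p` for `p ≠ 2`: every `x` is `y + y`. [folklore] -/
private theorem exists_add_self_eq (hp : p ≠ 2) (x : ℤ_[p]) : ∃ y : ℤ_[p], y + y = x := by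
  have h2 : IsUnit ((2 : ℕ) : ℤ_[p]) := by
    rw [PadicInt.isUnit_iff, PadicInt.norm_natCast_eq_one_iff]
    exact (Nat.coprime_primes (Fact.out : p.Prime) Nat.prime_two).mpr hp
  obtain ⟨u, hu⟩ := h2
  refine ⟨(↑u⁻¹ : ℤ_[p]) * x, ?_⟩
  rw [← two_mul, ← mul_assoc]
  have : (2 : ℤ_[p]) * ↑u⁻¹ = 1 := by
    rw [show (2 : ℤ_[p]) = ((2 : ℕ) : ℤ_[p]) by norm_num, ← hu, Units.mul_inv]
  rw [this, one_mul]

/-- **Anticyclotomic descent.** Let `κ` be a `ℤ_p`-extension of `K`, `p` odd, and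
`c : Γ_K → Γ_K` a map inverting `κ` (`κ (c σ) = (κ σ)⁻¹`; in the application `c` is the outer
conjugation by some `ρ ∈ Γ_ℚ ∖ Γ_K` and this is the relation `ZpExtension.IsAnticyclotomic`). A
multiplicative map `ψ : Γ_K → M` to a monoid which factors through `κ` (`κ σ = κ τ → ψ σ = ψ τ`) and
is `c`-invariant (`ψ (c σ) = ψ σ`) is trivial. Proof: write `κ σ = y + y` in `ℤ_p` (`p` odd) and
pick `σ_h` with `κ σ_h = y`; then `ψ σ = ψ σ_h ψ σ_h`, while `κ (σ_h · c σ_h) = 0` gives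
`ψ σ_h ψ σ_h = ψ σ_h ψ (c σ_h) = ψ 1 = 1`. [folklore] -/
private theorem eq_one_of_isAnticyclotomic (κ : ZpExtension K p) (hp : p ≠ 2) {M : Type*} [Monoid M]
    (ψ : absoluteGaloisGroup K → M) (hone : ψ 1 = 1) (hmul : ∀ σ τ, ψ (σ * τ) = ψ σ * ψ τ)
    (hfac : ∀ σ τ, κ σ = κ τ → ψ σ = ψ τ) (c : absoluteGaloisGroup K → absoluteGaloisGroup K)
    (hc : ∀ σ, κ (c σ) = (κ σ)⁻¹) (hψc : ∀ σ, ψ (c σ) = ψ σ) (σ : absoluteGaloisGroup K) :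
    ψ σ = 1 := by
  obtain ⟨y, hy⟩ := exists_add_self_eq hp (Multiplicative.toAdd (κ σ))
  obtain ⟨σh, hσh⟩ := κ.surjective (Multiplicative.ofAdd y)
  rw [coe_toContinuousMonoidHom] at hσh
  have h1 : κ (σh * σh) = κ σ := by
    rw [map_mul, hσh, ← ofAdd_add, hy, ofAdd_toAdd]
  have h2 : κ (σh * c σh) = κ 1 := by
    rw [map_mul, hc, mul_inv_cancel, map_one]
  have h3 : ψ σh * ψ σh = 1 := by
    have h4 := hfac _ _ h2
    rwa [hmul, hψc, hone] at h4
  rw [← hfac _ _ h1, hmul, h3]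

end Descent

/-! ### §2 The outer conjugation by `ρ ∈ Γ_ℚ ∖ Γ_K` on `K̄` and on the layers -/

section Conj

variable (K : Type) [Field K] [NumberField K]

/-- `Γ_K` has index `[K : ℚ]` in `Γ_ℚ` (`index_range_absGaloisRestrict_eq_finrank`); for
`[K : ℚ] = 2` there is `ρ ∈ Γ_ℚ ∖ res(Γ_K)`. [folklore] -/
private theorem exists_not_mem_range_absGaloisRestrict_of_finrank_eq_two
    (hK2 : Module.finrank ℚ K = 2) :
    ∃ ρ : absoluteGaloisGroup ℚ, ρ ∉ Set.range (absGaloisRestrict ℚ K) := by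
  by_contra h
  simp only [not_exists, not_not] at h
  have htop : (absGaloisRestrict ℚ K).range = ⊤ :=
    (Subgroup.eq_top_iff' _).mpr fun ρ => MonoidHom.mem_range.mpr (h ρ)
  have hidx := index_range_absGaloisRestrict_eq_finrank ℚ K
  rw [htop, Subgroup.index_top, hK2] at hidx
  exact absurd hidx (by norm_num)

/-- **The outer `ρ`-conjugation is a conjugation by a ring automorphism of `K̄`.** For
`ρ ∈ Γ_ℚ` there is a `ℚ`-algebra automorphism `g` of `K̄` (namely `ι ∘ ρ ∘ ι⁻¹` for the tree's
identification `ι = absClosureEquiv ℚ K : ℚ̄ ≅ K̄`) with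
`(ρ σ ρ⁻¹)(y) = g (σ (g⁻¹ y))` for all `σ ∈ Γ_K`, `y ∈ K̄`, where
`ρ σ ρ⁻¹ := absGaloisOuterConjFun ℚ K ρ σ`. [folklore] -/
private theorem exists_outerConj_eq_conj [IsGalois ℚ K] (ρ : absoluteGaloisGroup ℚ) :
    ∃ g : AlgebraicClosure K ≃ₐ[ℚ] AlgebraicClosure K,
      ∀ (σ : absoluteGaloisGroup K) (y : AlgebraicClosure K),
        absGaloisOuterConjFun ℚ K ρ σ • y = g (σ • g.symm y) := by
  let ι : AlgebraicClosure ℚ ≃ₐ[ℚ] AlgebraicClosure K := absClosureEquiv ℚ K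
  let ρ' : AlgebraicClosure ℚ ≃ₐ[ℚ] AlgebraicClosure ℚ := absoluteGaloisGroup.toAlgEquiv ℚ ρ
  refine ⟨(ι.symm.trans ρ').trans ι, fun σ y => ?_⟩
  obtain ⟨x, rfl⟩ := ι.surjective y
  -- left-hand side: `τ • ι x = ι (res τ • x)` for `τ = ρ σ ρ⁻¹`, `res τ = ρ · res σ · ρ⁻¹`
  have lhs : absGaloisOuterConjFun ℚ K ρ σ • ι x =
      ι ((ρ * absGaloisRestrict ℚ K σ * ρ⁻¹) • x) := by
    rw [← absGaloisRestrict_absGaloisOuterConjFun ℚ K ρ σ]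
    exact (absGaloisRestrict_apply_smul ℚ K _ x).symm
  rw [lhs, mul_smul, mul_smul]
  simp only [AlgEquiv.trans_apply, AlgEquiv.symm_trans_apply, AlgEquiv.symm_symm,
    AlgEquiv.symm_apply_apply]
  have hρ : ∀ z : AlgebraicClosure ℚ, ρ • z = ρ' z := fun z => rfl
  have hinv : ∀ z : AlgebraicClosure ℚ, ρ⁻¹ • z = ρ'.symm z := fun z => rfl
  rw [hρ, hinv]
  simp only [EmbeddingLike.apply_eq_iff_eq]
  rw [AlgEquiv.eq_symm_apply]
  exact absGaloisRestrict_apply_smul ℚ K σ (ρ'.symm x)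

variable {K} {p : ℕ} [Fact p.Prime] (κ : ZpExtension K p)

omit [NumberField K] in
/-- Membership in the layer `K_n = K̄^{κ⁻¹(pⁿℤ_p)}`: `y ∈ K_n` iff every `σ ∈ κ⁻¹(pⁿℤ_p)` fixes `y`
(the definition, `ZpExtension.layer`). [folklore] -/
private theorem mem_layer_iff (n : ℕ) (y : AlgebraicClosure K) :
    y ∈ κ.layer n ↔ ∀ σ ∈ κ.layerSubgroup n, σ • y = y := by
  rw [ZpExtension.layer, IntermediateField.mem_fixedField_iff]
  constructor
  · intro h σ hσ
    exact h _ (Subgroup.mem_map_of_mem _ hσ)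
  · intro h f hf
    obtain ⟨σ, hσ, rfl⟩ := Subgroup.mem_map.mp hf
    exact h σ hσ

omit [NumberField K] in
/-- A `K`-automorphism of `K̄` preserves the layers (`κ⁻¹(pⁿℤ_p)` is normal in `Γ_K`). [folklore] -/
private theorem smul_mem_layer (n : ℕ) (σ : absoluteGaloisGroup K) {y : AlgebraicClosure K}
    (hy : y ∈ κ.layer n) : σ • y ∈ κ.layer n := by
  rw [mem_layer_iff] at hy ⊢
  intro τ hτ
  have hτ' : σ⁻¹ * τ * σ ∈ κ.layerSubgroup n := by
    have := (κ.layerSubgroup_normal n).conj_mem _ hτ σ⁻¹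
    simpa using this
  calc τ • σ • y = σ • ((σ⁻¹ * τ * σ) • y) := by
        rw [mul_smul, mul_smul, smul_inv_smul]
    _ = σ • y := by rw [hy _ hτ']

/-- The layer subgroups are stable under every outer conjugation inverting `κ`: if
`κ (ρ τ ρ⁻¹) = (κ τ)⁻¹` (anticyclotomic relation) then `pⁿ ∣ κ τ` implies `pⁿ ∣ κ (ρ τ ρ⁻¹)`.
[folklore] -/
private theorem outerConj_mem_layerSubgroup [IsGalois ℚ K] (hκ : κ.IsAnticyclotomic)
    {ρ : absoluteGaloisGroup ℚ} (hρ : ρ ∉ Set.range (absGaloisRestrict ℚ K)) (n : ℕ)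
    {τ : absoluteGaloisGroup K} (hτ : τ ∈ κ.layerSubgroup n) :
    absGaloisOuterConjFun ℚ K ρ τ ∈ κ.layerSubgroup n := by
  have h := hκ τ (absGaloisOuterConjFun ℚ K ρ τ) ρ hρ
    (absGaloisRestrict_absGaloisOuterConjFun ℚ K ρ τ)
  rw [mem_layerSubgroup] at hτ ⊢
  rw [h, toAdd_inv]
  exact (dvd_neg).mpr hτ

/-- `ρ (ρ⁻¹ τ ρ) ρ⁻¹ = τ`: the outer conjugations by `ρ` and `ρ⁻¹` are inverse to each other
(injectivity of `res : Γ_K → Γ_ℚ`). [folklore] -/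
private theorem outerConj_outerConj_inv [IsGalois ℚ K] (ρ : absoluteGaloisGroup ℚ)
    (τ : absoluteGaloisGroup K) :
    absGaloisOuterConjFun ℚ K ρ (absGaloisOuterConjFun ℚ K ρ⁻¹ τ) = τ := by
  apply absGaloisRestrict_injective ℚ K
  rw [absGaloisRestrict_absGaloisOuterConjFun, absGaloisRestrict_absGaloisOuterConjFun]
  group

/-- **The transported conjugation `g_ρ` preserves the layers** (`K_n/ℚ` is Galois for an
anticyclotomic `κ`): if `g` realises the outer `ρ`-conjugation (`exists_outerConj_eq_conj`) and
`ρ ∉ Γ_K`, then `g (K_n) ⊆ K_n` and `g⁻¹ (K_n) ⊆ K_n`. [folklore] -/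
private theorem conj_apply_mem_layer [IsGalois ℚ K] (hκ : κ.IsAnticyclotomic) {ρ : absoluteGaloisGroup ℚ}
    (hρ : ρ ∉ Set.range (absGaloisRestrict ℚ K))
    {g : AlgebraicClosure K ≃ₐ[ℚ] AlgebraicClosure K}
    (hg : ∀ (σ : absoluteGaloisGroup K) (y : AlgebraicClosure K),
      absGaloisOuterConjFun ℚ K ρ σ • y = g (σ • g.symm y))
    (n : ℕ) {y : AlgebraicClosure K} (hy : y ∈ κ.layer n) :
    g y ∈ κ.layer n ∧ g.symm y ∈ κ.layer n := by
  rw [mem_layer_iff] at hy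
  constructor
  · rw [mem_layer_iff]
    intro τ hτ
    have hρ' : ρ⁻¹ ∉ Set.range (absGaloisRestrict ℚ K) := by
      rintro ⟨σ, hσ⟩
      exact hρ ⟨σ⁻¹, by rw [map_inv, hσ, inv_inv]⟩
    have hσ' := outerConj_mem_layerSubgroup κ hκ hρ' n hτ
    rw [← outerConj_outerConj_inv ρ τ, hg, AlgEquiv.symm_apply_apply, hy _ hσ']
  · rw [mem_layer_iff]
    intro σ hσ
    have h := hg σ y
    rw [hy _ (outerConj_mem_layerSubgroup κ hκ hρ n hσ)] at h
    -- `y = g (σ • g.symm y)` ⟹ `g.symm y = σ • g.symm y`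
    have := congrArg g.symm h
    rw [AlgEquiv.symm_apply_apply] at this
    exact this.symm

end Conj

/-! ### §3 Points of `E` over `K̄`: the action of ring endomorphisms of `K̄`, fixed points -/

section Points

variable {K : Type} [Field K] [NumberField K] (W : WeierstrassCurve ℚ)

/-- Functoriality of `Point.map` along ring homomorphisms of `K̄` (read as `ℚ`-algebra maps).
[folklore] -/
private theorem map_toRatAlgHom_comp (φ χ : AlgebraicClosure K →+* AlgebraicClosure K)
    (P : (W.baseChange (AlgebraicClosure K)).toAffine.Point) :
    WeierstrassCurve.Affine.Point.map (W' := W) (φ.comp χ).toRatAlgHom P =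
      WeierstrassCurve.Affine.Point.map (W' := W) φ.toRatAlgHom
        (WeierstrassCurve.Affine.Point.map (W' := W) χ.toRatAlgHom P) := by
  have hcomp : (φ.comp χ).toRatAlgHom = φ.toRatAlgHom.comp χ.toRatAlgHom :=
    AlgHom.ext fun _ => rfl
  rw [WeierstrassCurve.Affine.Point.map_map, hcomp]

/-- `Point.map` along the identity is the identity. [folklore] -/
private theorem map_toRatAlgHom_id (P : (W.baseChange (AlgebraicClosure K)).toAffine.Point) :
    WeierstrassCurve.Affine.Point.map (W' := W)
      (RingHom.id (AlgebraicClosure K)).toRatAlgHom P = P := by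
  rcases P with _ | ⟨x, y, h⟩ <;> rfl

/-- A ring endomorphism of `K̄` fixing the subfield `F` pointwise fixes the image of `E(F)` in
`E(K̄)`. [folklore] -/
private theorem map_map_eq_of_forall_apply_eq (F : IntermediateField K (AlgebraicClosure K)) [DecidableEq F]
    (φ : AlgebraicClosure K →+* AlgebraicClosure K)
    (hφ : ∀ y : F, φ (algebraMap F (AlgebraicClosure K) y) = algebraMap F (AlgebraicClosure K) y)
    (R : (W.baseChange F).toAffine.Point) :
    WeierstrassCurve.Affine.Point.map (W' := W) φ.toRatAlgHom
        (WeierstrassCurve.Affine.Point.map (W' := W)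
          (algebraMap F (AlgebraicClosure K)).toRatAlgHom R) =
      WeierstrassCurve.Affine.Point.map (W' := W)
        (algebraMap F (AlgebraicClosure K)).toRatAlgHom R := by
  have hcomp : φ.toRatAlgHom.comp (algebraMap F (AlgebraicClosure K)).toRatAlgHom =
      (algebraMap F (AlgebraicClosure K)).toRatAlgHom := AlgHom.ext fun y => hφ y
  rw [WeierstrassCurve.Affine.Point.map_map, hcomp]

/-- A ring endomorphism `φ` of `K̄` with `φ(F) ⊆ F` carries the image of `E(F)` in `E(K̄)` into
itself. [folklore] -/
private theorem exists_map_eq_map (F : IntermediateField K (AlgebraicClosure K)) [DecidableEq F]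
    (φ : AlgebraicClosure K →+* AlgebraicClosure K) (hφ : ∀ y ∈ F, φ y ∈ F)
    (R : (W.baseChange F).toAffine.Point) :
    ∃ R' : (W.baseChange F).toAffine.Point,
      WeierstrassCurve.Affine.Point.map (W' := W) φ.toRatAlgHom
          (WeierstrassCurve.Affine.Point.map (W' := W)
            (algebraMap F (AlgebraicClosure K)).toRatAlgHom R) =
        WeierstrassCurve.Affine.Point.map (W' := W)
          (algebraMap F (AlgebraicClosure K)).toRatAlgHom R' := by
  rcases R with _ | ⟨x, y, hxy⟩
  · exact ⟨0, rfl⟩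
  · have hL : (W.baseChange (AlgebraicClosure K)).toAffine.Nonsingular
        (algebraMap F (AlgebraicClosure K) x) (algebraMap F (AlgebraicClosure K) y) :=
      (WeierstrassCurve.Affine.baseChange_nonsingular W
        (f := (algebraMap F (AlgebraicClosure K)).toRatAlgHom)
        (algebraMap F (AlgebraicClosure K)).injective x y).mpr hxy
    have hφL : (W.baseChange (AlgebraicClosure K)).toAffine.Nonsingular
        (φ (algebraMap F (AlgebraicClosure K) x)) (φ (algebraMap F (AlgebraicClosure K) y)) :=
      (WeierstrassCurve.Affine.baseChange_nonsingular W (f := φ.toRatAlgHom) φ.injective _ _).mpr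
        hL
    exact ⟨.some (x := ⟨φ (algebraMap F (AlgebraicClosure K) x), hφ _ x.2⟩)
      (y := ⟨φ (algebraMap F (AlgebraicClosure K) y), hφ _ y.2⟩)
      ((WeierstrassCurve.Affine.baseChange_nonsingular W
        (f := (algebraMap F (AlgebraicClosure K)).toRatAlgHom)
        (algebraMap F (AlgebraicClosure K)).injective _ _).mp hφL), rfl⟩

/-- **A `Γ_K`-fixed point of `E(K̄)` is `K`-rational** (`K̄/K` Galois, `K` perfect: both
coordinates lie in `K`, Mathlib `InfiniteGalois.mem_range_algebraMap_iff_fixed`). [folklore] -/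
private theorem exists_map_eq_of_forall_map_eq (Q : (W.baseChange (AlgebraicClosure K)).toAffine.Point)
    (hQ : ∀ σ : absoluteGaloisGroup K,
      WeierstrassCurve.Affine.Point.map (W' := W)
        (MulSemiringAction.toRingHom (absoluteGaloisGroup K) (AlgebraicClosure K) σ).toRatAlgHom
          Q = Q) :
    ∃ Q₀ : (W.baseChange K).toAffine.Point,
      WeierstrassCurve.Affine.Point.map (W' := W)
        (algebraMap K (AlgebraicClosure K)).toRatAlgHom Q₀ = Q := by
  rcases Q with _ | ⟨x, y, hxy⟩
  · exact ⟨0, rfl⟩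
  · have hco : ∀ f : AlgebraicClosure K ≃ₐ[K] AlgebraicClosure K, f x = x ∧ f y = y := by
      intro f
      have h := hQ ((absoluteGaloisGroup.toAlgEquiv K).symm f)
      simp only [WeierstrassCurve.Affine.Point.map_some,
        WeierstrassCurve.Affine.Point.some.injEq] at h
      exact ⟨h.1, h.2⟩
    obtain ⟨x₀, rfl⟩ := (InfiniteGalois.mem_range_algebraMap_iff_fixed x).mpr fun f => (hco f).1
    obtain ⟨y₀, rfl⟩ := (InfiniteGalois.mem_range_algebraMap_iff_fixed y).mpr fun f => (hco f).2
    have h₀ : (W.baseChange K).toAffine.Nonsingular x₀ y₀ :=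
      (WeierstrassCurve.Affine.baseChange_nonsingular W
        (f := (algebraMap K (AlgebraicClosure K)).toRatAlgHom)
        (algebraMap K (AlgebraicClosure K)).injective x₀ y₀).mp hxy
    refine ⟨WeierstrassCurve.Affine.Point.some x₀ y₀ h₀, ?_⟩
    rfl

/-- Any two additive endomorphisms of a cyclic group `ℤ·c` commute. [folklore] -/
private theorem addMonoidHom_zmultiples_comm {G : Type*} [AddCommGroup G] (c : G)
    (f h : AddSubgroup.zmultiples c →+ AddSubgroup.zmultiples c)
    (x : AddSubgroup.zmultiples c) : f (h x) = h (f x) := by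
  have hgen : ∀ z : AddSubgroup.zmultiples c, ∃ k : ℤ,
      z = k • (⟨c, AddSubgroup.mem_zmultiples c⟩ : AddSubgroup.zmultiples c) := by
    intro z
    obtain ⟨k, hk⟩ := AddSubgroup.mem_zmultiples_iff.mp z.2
    exact ⟨k, Subtype.ext (by rw [AddSubgroup.coe_zsmul]; exact hk.symm)⟩
  obtain ⟨a, ha⟩ := hgen (f ⟨c, AddSubgroup.mem_zmultiples c⟩)
  obtain ⟨b, hb⟩ := hgen (h ⟨c, AddSubgroup.mem_zmultiples c⟩)
  obtain ⟨k, rfl⟩ := hgen x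
  rw [map_zsmul, map_zsmul, hb, map_zsmul, ha, map_zsmul, map_zsmul, ha, map_zsmul, hb, smul_smul,
    smul_smul, smul_smul, smul_smul, mul_right_comm]

end Points

/-! ### §4 Group theory: a finite abelian group inside `E[e] ≅ (ℤ/e)²` -/

section GroupTheory

/-- **Structure of a finite subgroup of `E(K̄)_{tors}`.** Let `T` be a finite abelian group of
exponent `e` with `#T ∣ e²` (e.g. `T ↪ E(K̄)[e]`, `#E[e] = e²`), and `P ∈ T` of order `e`. With
`d = [T : ℤP]`: `d ∣ e`, `#T = e d`, `d T ⊆ ℤ(dP)` and `#T[d] ≥ d²`. (This is the pair of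
invariant factors `(d, e)` of `T ≅ ℤ/d ⊕ ℤ/e`, obtained without the structure theorem.)
[folklore] -/
private theorem exists_index_sq_le_card_torsionBy {T : Type*} [AddCommGroup T] [Finite T] {e : ℕ}
    (he : AddMonoid.exponent T = e) {P : T} (hP : addOrderOf P = e) (hT : Nat.card T ∣ e ^ 2) :
    ∃ d : ℕ, 0 < d ∧ d ∣ e ∧ Nat.card T = e * d ∧
      (∀ x : T, d • x ∈ AddSubgroup.zmultiples (d • P)) ∧
      d ^ 2 ≤ Nat.card (AddSubgroup.torsionBy T d) := by
  have he0 : 0 < e := by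
    rw [← he]; exact AddMonoid.exponent_pos.mpr AddMonoid.ExponentExists.of_finite
  have hZcard : Nat.card (AddSubgroup.zmultiples P) = e := by rw [Nat.card_zmultiples, hP]
  obtain ⟨d, hd⟩ : ∃ d, d = Nat.card (T ⧸ AddSubgroup.zmultiples P) := ⟨_, rfl⟩
  have hcard : Nat.card T = e * d := by
    rw [AddSubgroup.card_eq_card_quotient_mul_card_addSubgroup (AddSubgroup.zmultiples P), hZcard,
      hd, mul_comm]
  have hd0 : 0 < d := by rw [hd]; exact Nat.card_pos
  have hde : d ∣ e := by
    have : e * d ∣ e * e := by rw [← hcard, ← sq]; exact hT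
    exact Nat.dvd_of_mul_dvd_mul_left he0 this
  -- `d T ⊆ ℤ (d P)`
  have hdT : ∀ x : T, d • x ∈ AddSubgroup.zmultiples (d • P) := by
    intro x
    have hq : d • (x : T ⧸ AddSubgroup.zmultiples P) = 0 := by
      rw [hd]; exact card_nsmul_eq_zero'
    rw [← QuotientAddGroup.mk_nsmul, QuotientAddGroup.eq_zero_iff] at hq
    obtain ⟨m, hm⟩ := AddSubgroup.mem_zmultiples_iff.mp hq
    -- `e • x = 0`, so `(e/d) m • P = 0`, so `e ∣ (e/d) m`, so `d ∣ m`
    have hex : e • x = 0 := by rw [← he]; exact AddMonoid.exponent_nsmul_eq_zero x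
    obtain ⟨e', he'⟩ : ∃ e', e = d * e' := hde
    have he'0 : e' ≠ 0 := by
      rintro rfl
      rw [mul_zero] at he'
      omega
    have h1 : ((e' : ℤ) * m) • P = 0 := by
      rw [mul_smul, hm, ← natCast_zsmul x d, smul_smul,
        show (e' : ℤ) * (d : ℤ) = (e : ℤ) by rw [he']; push_cast; ring, natCast_zsmul, hex]
    have h2 : (e : ℤ) ∣ (e' : ℤ) * m := by
      rw [← hP]; exact addOrderOf_dvd_iff_zsmul_eq_zero.mpr h1
    rw [he', Nat.cast_mul, mul_comm (d : ℤ) (e' : ℤ)] at h2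
    obtain ⟨m', rfl⟩ := (mul_dvd_mul_iff_left (by exact_mod_cast he'0 : (e' : ℤ) ≠ 0)).mp h2
    rw [AddSubgroup.mem_zmultiples_iff]
    exact ⟨m', by rw [← hm, ← natCast_zsmul P d, smul_smul, mul_comm]⟩
  refine ⟨d, hd0, hde, hcard, hdT, ?_⟩
  -- counting: `#T = #T[d] · #(dT)` and `#(dT) ≤ #ℤ(dP) = e / d`
  let f : T →+ T := zsmulAddGroupHom (d : ℤ)
  have hker : f.ker = AddSubgroup.torsionBy T d := by
    ext x
    rw [AddMonoidHom.mem_ker, AddSubgroup.torsionBy, Submodule.mem_toAddSubgroup,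
      Submodule.mem_torsionBy_iff]
    rfl
  have hrange : f.range ≤ AddSubgroup.zmultiples (d • P) := by
    rintro _ ⟨x, rfl⟩
    change (d : ℤ) • x ∈ _
    rw [natCast_zsmul]
    exact hdT x
  have hdPord : addOrderOf (d • P) = e / d := by
    rw [addOrderOf_nsmul_of_dvd hd0.ne' (by rw [hP]; exact hde), hP]
  have h1 : Nat.card T = Nat.card (AddSubgroup.torsionBy T d) * Nat.card f.range := by
    rw [AddSubgroup.card_eq_card_quotient_mul_card_addSubgroup f.ker,
      Nat.card_congr (QuotientAddGroup.quotientKerEquivRange f).toEquiv, hker, mul_comm]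
  have h2 : Nat.card f.range ≤ e / d := by
    calc Nat.card f.range ≤ Nat.card (AddSubgroup.zmultiples (d • P)) :=
          AddSubgroup.card_le_of_le hrange
      _ = e / d := by rw [Nat.card_zmultiples, hdPord]
  have h3 : e * d ≤ Nat.card (AddSubgroup.torsionBy T d) * (e / d) := by
    rw [← hcard, h1]; exact Nat.mul_le_mul_left _ h2
  have h4 : e * d * d ≤ Nat.card (AddSubgroup.torsionBy T d) * e := by
    calc e * d * d ≤ Nat.card (AddSubgroup.torsionBy T d) * (e / d) * d :=
          Nat.mul_le_mul_right _ h3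
      _ = Nat.card (AddSubgroup.torsionBy T d) * e := by
          rw [mul_assoc, Nat.div_mul_cancel hde]
  have h5 : d * d * e ≤ Nat.card (AddSubgroup.torsionBy T d) * e := by
    calc d * d * e = e * d * d := by ring
      _ ≤ _ := h4
  rw [sq]
  exact Nat.le_of_mul_le_mul_right h5 he0

end GroupTheory

/-! ### §5 Roots of unity in `K` -/

section RootsOfUnity

variable {K : Type} [Field K] [NumberField K]

omit [NumberField K] in
/-- A primitive `d`-th root of unity in a (number) field `K` has order dividing
`w_K = #(𝓞 K)ˣ_{tors}` (`NumberField.Units.torsionOrder`). [folklore] -/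
private theorem dvd_torsionOrder_of_isPrimitiveRoot {z : K} {d : ℕ} (hd : 0 < d)
    (hz : IsPrimitiveRoot z d) : d ∣ NumberField.Units.torsionOrder K := by
  let z₀ : 𝓞 K := ⟨z, hz.isIntegral hd⟩
  have hz' : IsPrimitiveRoot (algebraMap (𝓞 K) K z₀) d := hz
  have hz₀ : IsPrimitiveRoot z₀ d := hz'.of_map_of_injective RingOfIntegers.coe_injective
  have hu : IsPrimitiveRoot (hz₀.isUnit hd.ne').unit d :=
    IsPrimitiveRoot.coe_units_iff.mp (by rw [IsUnit.unit_spec]; exact hz₀)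
  have hmem : (hz₀.isUnit hd.ne').unit ∈ NumberField.Units.torsion K := by
    rw [NumberField.Units.torsion, CommGroup.mem_torsion, isOfFinOrder_iff_pow_eq_one]
    exact ⟨d, hd, hu.pow_eq_one⟩
  rw [NumberField.Units.torsionOrder, hu.eq_orderOf,
    orderOf_submonoid (⟨_, hmem⟩ : NumberField.Units.torsion K)]
  exact orderOf_dvd_natCard _

/-- If two `R`-automorphisms agree on the primitive root `μ`, their cyclotomic characters
`IsPrimitiveRoot.autToPow` agree. [folklore] -/
private theorem autToPow_eq_of_apply_eq {S R : Type*} [CommRing S] [IsDomain S] [CommRing R] [Algebra R S]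
    {μ : S} {d : ℕ} [NeZero d] (hμ : IsPrimitiveRoot μ d) {f f' : S ≃ₐ[R] S} (h : f μ = f' μ) :
    hμ.autToPow R f = hμ.autToPow R f' := by
  ext
  have e1 := hμ.autToPow_spec R f
  have e2 := hμ.autToPow_spec R f'
  rw [h, ← e2] at e1
  exact ZMod.val_injective d (hμ.pow_inj (ZMod.val_lt _) (ZMod.val_lt _) e1)

end RootsOfUnity

/-! ### §6 The two descents and the assembly -/

section Main

variable {K : Type} [Field K] [NumberField K] {p : ℕ} [Fact p.Prime]

/-- **Roots of unity in the anticyclotomic tower come from `K`.** For `K` quadratic, `p` odd, `κ`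
anticyclotomic: a primitive `d`-th root of unity lying in a layer `K_n` lies in `K`; in particular
`d ∣ w_K`. (The cyclotomic character `Γ_K → (ℤ/d)ˣ` is conjugation-invariant and factors through
`Gal(K_n/K)`; descent lemma.) [folklore] -/
private theorem dvd_torsionOrder_of_isPrimitiveRoot_layer (hK2 : Module.finrank ℚ K = 2) (hp : p ≠ 2)
    (κ : ZpExtension K p) (hκ : κ.IsAnticyclotomic) (n : ℕ) {d : ℕ} (hd : 0 < d)
    {ζ : AlgebraicClosure K} (hζmem : ζ ∈ κ.layer n) (hζ : IsPrimitiveRoot ζ d) :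
    d ∣ NumberField.Units.torsionOrder K := by
  haveI : NeZero d := ⟨hd.ne'⟩
  haveI : Algebra.IsQuadraticExtension ℚ K := ⟨hK2⟩
  haveI : IsGalois ℚ K := inferInstance
  obtain ⟨ρ, hρ⟩ := exists_not_mem_range_absGaloisRestrict_of_finrank_eq_two K hK2
  obtain ⟨g, hg⟩ := exists_outerConj_eq_conj K ρ
  -- the cyclotomic character `σ ↦ autToPow σ`
  have hone : hζ.autToPow K (absoluteGaloisGroup.toAlgEquiv K 1) = 1 := by simp
  have hmul : ∀ σ τ : absoluteGaloisGroup K,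
      hζ.autToPow K (absoluteGaloisGroup.toAlgEquiv K (σ * τ)) =
        hζ.autToPow K (absoluteGaloisGroup.toAlgEquiv K σ) *
          hζ.autToPow K (absoluteGaloisGroup.toAlgEquiv K τ) := by
    intro σ τ; simp [map_mul]
  -- factors through `κ`: `σ⁻¹ τ ∈ ker κ ≤ κ⁻¹(pⁿ)` fixes `ζ ∈ K_n`
  have hfac : ∀ σ τ : absoluteGaloisGroup K, κ σ = κ τ →
      hζ.autToPow K (absoluteGaloisGroup.toAlgEquiv K σ) =
        hζ.autToPow K (absoluteGaloisGroup.toAlgEquiv K τ) := by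
    intro σ τ hστ
    apply autToPow_eq_of_apply_eq
    have hmem : σ⁻¹ * τ ∈ κ.layerSubgroup n := by
      apply κ.kerSubgroup_le_layerSubgroup n
      rw [mem_kerSubgroup, map_mul, map_inv, hστ, inv_mul_cancel]
    have h := (mem_layer_iff κ n ζ).mp hζmem _ hmem
    rw [mul_smul, inv_smul_eq_iff] at h
    exact h.symm
  -- invariance under the outer `ρ`-conjugation
  have hψc : ∀ σ : absoluteGaloisGroup K,
      hζ.autToPow K (absoluteGaloisGroup.toAlgEquiv K (absGaloisOuterConjFun ℚ K ρ σ)) =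
        hζ.autToPow K (absoluteGaloisGroup.toAlgEquiv K σ) := by
    intro σ
    apply autToPow_eq_of_apply_eq
    change absGaloisOuterConjFun ℚ K ρ σ • ζ = σ • ζ
    rw [hg]
    -- `g⁻¹ ζ = ζ^a`, `g ζ = ζ^b`, `σ ζ = ζ^k`, `ζ = ζ^(b a)`
    have hζ1 : (g.symm ζ) ^ d = 1 := by rw [← map_pow, hζ.pow_eq_one, map_one]
    obtain ⟨a, -, ha⟩ := hζ.eq_pow_of_pow_eq_one hζ1
    have hζ2 : (g ζ) ^ d = 1 := by rw [← map_pow, hζ.pow_eq_one, map_one]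
    obtain ⟨b, -, hb⟩ := hζ.eq_pow_of_pow_eq_one hζ2
    have hσζ : (σ • ζ) ^ d = 1 := by rw [← smul_pow', hζ.pow_eq_one, smul_one]
    obtain ⟨k, -, hk⟩ := hζ.eq_pow_of_pow_eq_one hσζ
    have hab : ζ ^ (b * a) = ζ := by
      conv_rhs => rw [← g.apply_symm_apply ζ, ← ha, map_pow, ← hb, ← pow_mul]
    rw [← ha, smul_pow', ← hk, ← pow_mul, map_pow, ← hb, ← pow_mul,
      show b * (k * a) = (b * a) * k by ring, pow_mul, hab]
  have hψ : ∀ σ : absoluteGaloisGroup K, hζ.autToPow K (absoluteGaloisGroup.toAlgEquiv K σ) = 1 :=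
    eq_one_of_isAnticyclotomic κ hp (fun σ => hζ.autToPow K (absoluteGaloisGroup.toAlgEquiv K σ))
      hone hmul hfac (absGaloisOuterConjFun ℚ K ρ)
      (fun σ => hκ σ _ ρ hρ (absGaloisRestrict_absGaloisOuterConjFun ℚ K ρ σ)) hψc
  -- so every `K`-automorphism of `K̄` fixes `ζ`, and `ζ ∈ K`
  have hfix : ∀ f : AlgebraicClosure K ≃ₐ[K] AlgebraicClosure K, f ζ = ζ := by
    intro f
    have h1 := hζ.autToPow_spec K f
    have h2 : hζ.autToPow K f = 1 := by
      have := hψ ((absoluteGaloisGroup.toAlgEquiv K).symm f)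
      rwa [MulEquiv.apply_symm_apply] at this
    rw [h2, Units.val_one] at h1
    rcases Nat.lt_or_ge 1 d with hd1 | hd1
    · haveI : Fact (1 < d) := ⟨hd1⟩
      rw [ZMod.val_one, pow_one] at h1
      exact h1.symm
    · -- `d = 1`: `ζ = 1`
      have hd' : d = 1 := le_antisymm hd1 hd
      subst hd'
      rw [IsPrimitiveRoot.one_right_iff.mp hζ, map_one]
  obtain ⟨z, hz⟩ := (InfiniteGalois.mem_range_algebraMap_iff_fixed ζ).mpr hfix
  have hz' : IsPrimitiveRoot z d := by
    rw [← hz] at hζ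
    exact hζ.of_map_of_injective (algebraMap K (AlgebraicClosure K)).injective
  exact dvd_torsionOrder_of_isPrimitiveRoot hd hz'

/-- **A torsion point of the anticyclotomic tower whose multiples form a Galois-stable cyclic group
is `K`-rational.** Setting: `K` quadratic, `p` odd, `κ` anticyclotomic, `W/ℚ`; `Q ∈ E(K̄)` of finite
order, fixed by `κ⁻¹(pⁿℤ_p)` (i.e. defined over `K_n`) and such that `ℤQ` is carried into itself
by every ring endomorphism of `K̄` preserving `K_n` (read on `E(K̄)` through `Point.map`). Then
`Q ∈ E(K)`, so its order is at most `#E(K)_{tors}`. (Descent lemma applied to the action of `Γ_K`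
on the cyclic group `ℤQ`, whose endomorphisms commute.) [folklore] -/
private theorem addOrderOf_le_card_torsion_of_stable (W : WeierstrassCurve ℚ) [W.IsElliptic]
    (hK2 : Module.finrank ℚ K = 2) (hp : p ≠ 2) (κ : ZpExtension K p) (hκ : κ.IsAnticyclotomic)
    (n : ℕ) (Q : (W.baseChange (AlgebraicClosure K)).toAffine.Point) (hQfin : IsOfFinAddOrder Q)
    (hQfix : ∀ σ ∈ κ.layerSubgroup n,
      WeierstrassCurve.Affine.Point.map (W' := W)
        (MulSemiringAction.toRingHom (absoluteGaloisGroup K) (AlgebraicClosure K) σ).toRatAlgHom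
          Q = Q)
    (hQstab : ∀ φ : AlgebraicClosure K →+* AlgebraicClosure K,
      (∀ y ∈ κ.layer n, φ y ∈ κ.layer n) →
        WeierstrassCurve.Affine.Point.map (W' := W) φ.toRatAlgHom Q ∈ AddSubgroup.zmultiples Q) :
    addOrderOf Q ≤ Nat.card (AddCommGroup.torsion (W.baseChange K).toAffine.Point) := by
  haveI : Algebra.IsQuadraticExtension ℚ K := ⟨hK2⟩
  haveI : IsGalois ℚ K := inferInstance
  obtain ⟨ρ, hρ⟩ := exists_not_mem_range_absGaloisRestrict_of_finrank_eq_two K hK2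
  obtain ⟨g, hg⟩ := exists_outerConj_eq_conj K ρ
  -- abbreviations: the action of ring endomorphisms of `K̄` on `E(K̄)`, and of `Γ_K`
  let act : (AlgebraicClosure K →+* AlgebraicClosure K) →
      (W.baseChange (AlgebraicClosure K)).toAffine.Point →+
        (W.baseChange (AlgebraicClosure K)).toAffine.Point :=
    fun φ => WeierstrassCurve.Affine.Point.map (W' := W) φ.toRatAlgHom
  let gal : absoluteGaloisGroup K → (AlgebraicClosure K →+* AlgebraicClosure K) :=
    fun σ => MulSemiringAction.toRingHom (absoluteGaloisGroup K) (AlgebraicClosure K) σ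
  have act_comp : ∀ φ χ P, act (φ.comp χ) P = act φ (act χ P) :=
    fun φ χ P => map_toRatAlgHom_comp W φ χ P
  have gal_mul : ∀ σ τ : absoluteGaloisGroup K, gal (σ * τ) = (gal σ).comp (gal τ) := by
    intro σ τ; ext y; simp [gal, mul_smul]
  have gal_one : gal 1 = RingHom.id (AlgebraicClosure K) := by ext y; simp [gal]
  -- the cyclic group `C = ℤ Q` and its stability
  set C := AddSubgroup.zmultiples Q with hC
  have hstabC : ∀ φ : AlgebraicClosure K →+* AlgebraicClosure K,
      (∀ y ∈ κ.layer n, φ y ∈ κ.layer n) → ∀ x ∈ C, act φ x ∈ C := by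
    intro φ hφ x hx
    obtain ⟨k, rfl⟩ := AddSubgroup.mem_zmultiples_iff.mp hx
    rw [map_zsmul]
    exact AddSubgroup.zsmul_mem _ (hQstab φ hφ) k
  have hgal_layer : ∀ σ : absoluteGaloisGroup K, ∀ y ∈ κ.layer n, gal σ y ∈ κ.layer n := by
    intro σ y hy
    simpa [gal] using smul_mem_layer κ n σ hy
  -- the restricted action `ψ : Γ_K → End(C)`
  let res : ∀ φ : AlgebraicClosure K →+* AlgebraicClosure K,
      (∀ y ∈ κ.layer n, φ y ∈ κ.layer n) → (C →+ C) :=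
    fun φ hφ => ((act φ).comp C.subtype).codRestrict C (fun x => hstabC φ hφ x x.2)
  let ψ : absoluteGaloisGroup K → AddMonoid.End C := fun σ => res (gal σ) (hgal_layer σ)
  have hψ1 : ∀ σ : absoluteGaloisGroup K, ψ σ = 1 := by
    refine eq_one_of_isAnticyclotomic κ hp ψ ?_ ?_ ?_ (absGaloisOuterConjFun ℚ K ρ)
      (fun σ => hκ σ _ ρ hρ (absGaloisRestrict_absGaloisOuterConjFun ℚ K ρ σ)) ?_
    · -- `ψ 1 = 1`
      refine DFunLike.ext _ _ fun x => Subtype.ext ?_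
      change act (gal 1) (x : (W.baseChange (AlgebraicClosure K)).toAffine.Point) = x
      rw [gal_one]
      exact map_toRatAlgHom_id W _
    · -- multiplicative
      intro σ τ
      refine DFunLike.ext _ _ fun x => Subtype.ext ?_
      change act (gal (σ * τ)) (x : (W.baseChange (AlgebraicClosure K)).toAffine.Point) =
        act (gal σ) (act (gal τ) x)
      rw [gal_mul, act_comp]
    · -- factors through `κ`
      intro σ τ hστ
      refine DFunLike.ext _ _ fun x => Subtype.ext ?_
      change act (gal σ) (x : (W.baseChange (AlgebraicClosure K)).toAffine.Point) = act (gal τ) x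
      have hmem : σ⁻¹ * τ ∈ κ.layerSubgroup n := by
        apply κ.kerSubgroup_le_layerSubgroup n
        rw [mem_kerSubgroup, map_mul, map_inv, hστ, inv_mul_cancel]
      -- `σ⁻¹ τ` fixes `Q`, hence `C`
      have hfixQ : act (gal (σ⁻¹ * τ)) Q = Q := hQfix _ hmem
      have hfixx : act (gal (σ⁻¹ * τ)) (x : (W.baseChange (AlgebraicClosure K)).toAffine.Point) =
          x := by
        obtain ⟨k, hk⟩ := AddSubgroup.mem_zmultiples_iff.mp x.2
        rw [← hk, map_zsmul, hfixQ]
      calc act (gal σ) (x : (W.baseChange (AlgebraicClosure K)).toAffine.Point)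
          = act (gal σ) (act (gal (σ⁻¹ * τ)) x) := by rw [hfixx]
        _ = act (gal τ) x := by rw [← act_comp, ← gal_mul, mul_inv_cancel_left]
    · -- invariance under the outer `ρ`-conjugation
      intro σ
      have hφ : ∀ y ∈ κ.layer n, (g : AlgebraicClosure K →+* AlgebraicClosure K) y ∈ κ.layer n :=
        fun y hy => (conj_apply_mem_layer κ hκ hρ hg n hy).1
      have hφ' : ∀ y ∈ κ.layer n,
          (g.symm : AlgebraicClosure K →+* AlgebraicClosure K) y ∈ κ.layer n :=
        fun y hy => (conj_apply_mem_layer κ hκ hρ hg n hy).2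
      -- `gal (ρσρ⁻¹) = g ∘ gal σ ∘ g⁻¹` as ring endomorphisms of `K̄`
      have hconj : gal (absGaloisOuterConjFun ℚ K ρ σ) =
          (g : AlgebraicClosure K →+* AlgebraicClosure K).comp
            ((gal σ).comp (g.symm : AlgebraicClosure K →+* AlgebraicClosure K)) := by
        ext y
        simpa [gal] using hg σ y
      have hgg : (g : AlgebraicClosure K →+* AlgebraicClosure K).comp
          (g.symm : AlgebraicClosure K →+* AlgebraicClosure K) =
            RingHom.id (AlgebraicClosure K) := by
        ext y; simp
      refine DFunLike.ext _ _ fun x => Subtype.ext ?_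
      change act (gal (absGaloisOuterConjFun ℚ K ρ σ))
          (x : (W.baseChange (AlgebraicClosure K)).toAffine.Point) = act (gal σ) x
      rw [hconj, act_comp, act_comp]
      -- commute the endomorphisms `res g` and `ψ σ` of the cyclic group `C`
      have key := addMonoidHom_zmultiples_comm Q (res _ hφ) (ψ σ) (res _ hφ' x)
      have key' : act (g : AlgebraicClosure K →+* AlgebraicClosure K) (act (gal σ)
          (act (g.symm : AlgebraicClosure K →+* AlgebraicClosure K)
            (x : (W.baseChange (AlgebraicClosure K)).toAffine.Point))) =
          act (gal σ) (act (g : AlgebraicClosure K →+* AlgebraicClosure K)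
            (act (g.symm : AlgebraicClosure K →+* AlgebraicClosure K) x)) :=
        congrArg Subtype.val key
      rw [key', ← act_comp (g : AlgebraicClosure K →+* AlgebraicClosure K), hgg]
      exact congrArg _ (map_toRatAlgHom_id W _)
  -- hence every `σ ∈ Γ_K` fixes `Q`
  have hfixall : ∀ σ : absoluteGaloisGroup K,
      WeierstrassCurve.Affine.Point.map (W' := W)
        (MulSemiringAction.toRingHom (absoluteGaloisGroup K) (AlgebraicClosure K) σ).toRatAlgHom
          Q = Q := by
    intro σ
    have h : act (gal σ) Q = Q :=
      congrArg (fun f : AddMonoid.End C => ((f ⟨Q, AddSubgroup.mem_zmultiples Q⟩ : C) :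
        (W.baseChange (AlgebraicClosure K)).toAffine.Point)) (hψ1 σ)
    exact h
  obtain ⟨Q₀, hQ₀⟩ := exists_map_eq_of_forall_map_eq W Q hfixall
  -- `Q₀` is torsion of the same order
  have hinj := WeierstrassCurve.Affine.Point.map_injective (W' := W)
    (f := (algebraMap K (AlgebraicClosure K)).toRatAlgHom)
  have hord : addOrderOf Q₀ = addOrderOf Q := by
    rw [← hQ₀]; exact (addOrderOf_injective _ hinj Q₀).symm
  have hQ₀fin : IsOfFinAddOrder Q₀ := by
    rw [← addOrderOf_pos_iff, hord, addOrderOf_pos_iff]; exact hQfin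
  haveI : Finite (AddCommGroup.torsion (W.baseChange K).toAffine.Point) :=
    (W.baseChange K).finite_torsion_point
  have hmemT : Q₀ ∈ AddCommGroup.torsion (W.baseChange K).toAffine.Point := hQ₀fin
  have h1 : addOrderOf (⟨Q₀, hmemT⟩ : AddCommGroup.torsion (W.baseChange K).toAffine.Point) =
      addOrderOf Q := by
    rw [← hord]; exact (AddSubgroup.addOrderOf_coe _).symm
  rw [← h1]
  exact Nat.le_of_dvd Nat.card_pos (addOrderOf_dvd_natCard _)

/-- **The bound at one layer.** For `W/ℚ` elliptic, `K` imaginary quadratic, `p` odd and `κ`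
anticyclotomic: `#E(K_n)_{tors} ≤ w_K² · #E(K)_{tors}` for every `n`.
[cite: LiXu2026, Prop. 5.2 (arXiv:2502.12648)] -/
theorem card_torsion_layer_le (W : WeierstrassCurve ℚ) [W.IsElliptic]
    (hK : IsImaginaryQuadratic K) (hp : p ≠ 2) (κ : ZpExtension K p) (hκ : κ.IsAnticyclotomic)
    (n : ℕ) :
    (W.baseChange (κ.layer n)).torsionOrder ≤
      NumberField.Units.torsionOrder K ^ 2 * (W.baseChange K).torsionOrder := by
  /- `WeierstrassCurve.torsionOrder` carries the classical `DecidableEq` instance of its definition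
  site (the group law on `W⟮F⟯` depends on `[DecidableEq F]`); fix that instance on the layer
  `K_n ⊂ K̄` (a subtype, which otherwise gets `Subtype.instDecidableEq`) for the whole proof. -/
  letI instDecLayer : DecidableEq (κ.layer n) := fun a b => Classical.propDecidable (a = b)
  show Nat.card (AddCommGroup.torsion (W.baseChange (κ.layer n)).toAffine.Point) ≤
      NumberField.Units.torsionOrder K ^ 2 *
        Nat.card (AddCommGroup.torsion (W.baseChange K).toAffine.Point)
  haveI : Finite (AddCommGroup.torsion (W.baseChange K).toAffine.Point) :=
    (W.baseChange K).finite_torsion_point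
  have ht0 : 0 < Nat.card (AddCommGroup.torsion (W.baseChange K).toAffine.Point) := Nat.card_pos
  have hw0 : 0 < NumberField.Units.torsionOrder K := NumberField.Units.torsionOrder_pos K
  haveI : CharZero (κ.layer n) :=
    charZero_of_injective_algebraMap (algebraMap K (κ.layer n)).injective
  -- infinite torsion has `Nat.card = 0`
  by_cases hfin : Finite (AddCommGroup.torsion (W.baseChange (κ.layer n)).toAffine.Point)
  swap
  · haveI : Infinite (AddCommGroup.torsion (W.baseChange (κ.layer n)).toAffine.Point) :=
      not_finite_iff_infinite.mp hfin
    rw [Nat.card_eq_zero_of_infinite]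
    exact Nat.zero_le _
  -- the embedding `ι : E(K_n) → E(K̄)` and the count `#E(K̄)[m] = m²`
  let ι : (W.baseChange (κ.layer n)).toAffine.Point →+
      (W.baseChange (AlgebraicClosure K)).toAffine.Point :=
    WeierstrassCurve.Affine.Point.map (W' := W)
      (algebraMap (κ.layer n) (AlgebraicClosure K)).toRatAlgHom
  have hι : Function.Injective ι :=
    WeierstrassCurve.Affine.Point.map_injective (W' := W)
      (f := (algebraMap (κ.layer n) (AlgebraicClosure K)).toRatAlgHom)
  have hcardL : ∀ m : ℕ, 0 < m →
      Nat.card (AddSubgroup.torsionBy (W.baseChange (AlgebraicClosure K)).toAffine.Point m) =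
        m ^ 2 := by
    intro m hm
    exact WeierstrassCurve.card_torsionBy_eq_sq (E := W.baseChange (AlgebraicClosure K))
      (Nat.cast_ne_zero.mpr hm.ne')
  -- exponent and an element of maximal order
  have hexp : AddMonoid.ExponentExists
      (AddCommGroup.torsion (W.baseChange (κ.layer n)).toAffine.Point) :=
    AddMonoid.ExponentExists.of_finite
  obtain ⟨P, hP⟩ := AddMonoid.exists_addOrderOf_eq_exponent hexp
  obtain ⟨e, he⟩ : ∃ e, e = AddMonoid.exponent
      (AddCommGroup.torsion (W.baseChange (κ.layer n)).toAffine.Point) := ⟨_, rfl⟩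
  rw [← he] at hP
  have he0 : 0 < e := by rw [he]; exact AddMonoid.exponent_pos.mpr hexp
  -- `#T ∣ e²`: `T ↪ E(K̄)[e]`
  have hTe : ∀ x : AddCommGroup.torsion (W.baseChange (κ.layer n)).toAffine.Point,
      e • (x : (W.baseChange (κ.layer n)).toAffine.Point) = 0 := by
    intro x
    have hx : e • x = 0 := by rw [he]; exact AddMonoid.exponent_nsmul_eq_zero x
    have := congrArg Subtype.val hx
    push_cast at this
    exact this
  have hdvd : Nat.card (AddCommGroup.torsion (W.baseChange (κ.layer n)).toAffine.Point) ∣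
      e ^ 2 := by
    rw [← hcardL e he0]
    let j : AddCommGroup.torsion (W.baseChange (κ.layer n)).toAffine.Point →+
        AddSubgroup.torsionBy (W.baseChange (AlgebraicClosure K)).toAffine.Point e :=
      (ι.comp (AddCommGroup.torsion (W.baseChange (κ.layer n)).toAffine.Point).subtype).codRestrict
        _ (fun x => by
          rw [AddSubgroup.torsionBy.nsmul_iff]
          change e • ι (x : (W.baseChange (κ.layer n)).toAffine.Point) = 0
          rw [← map_nsmul, hTe x, map_zero])
    refine AddSubgroup.card_dvd_of_injective j fun x y hxy => ?_
    have h2 : ι (x : (W.baseChange (κ.layer n)).toAffine.Point) = ι y := congrArg Subtype.val hxy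
    exact Subtype.ext (hι h2)
  -- the structure lemma
  obtain ⟨d, hd0, hde, hcardT, hdT, hsq⟩ := exists_index_sq_le_card_torsionBy he.symm hP hdvd
  -- `#E(K_n)[d] = d²`
  have hAd : Nat.card (AddSubgroup.torsionBy (W.baseChange (κ.layer n)).toAffine.Point d) =
      d ^ 2 := by
    apply le_antisymm
    · -- `E(K_n)[d] ↪ E(K̄)[d]`
      rw [← hcardL d hd0]
      haveI : Finite
          (AddSubgroup.torsionBy (W.baseChange (AlgebraicClosure K)).toAffine.Point d) :=
        Nat.finite_of_card_ne_zero (by rw [hcardL d hd0]; positivity)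
      refine Nat.card_le_card_of_injective
        (fun x => (⟨ι (x : (W.baseChange (κ.layer n)).toAffine.Point), ?_⟩ :
          AddSubgroup.torsionBy (W.baseChange (AlgebraicClosure K)).toAffine.Point d)) ?_
      · rw [AddSubgroup.torsionBy.nsmul_iff, ← map_nsmul, AddSubgroup.torsionBy.nsmul_iff.mp x.2,
          map_zero]
      · intro x y hxy
        have h2 : ι (x : (W.baseChange (κ.layer n)).toAffine.Point) = ι y :=
          congrArg Subtype.val hxy
        exact Subtype.ext (hι h2)
    · -- `T[d] ↪ E(K_n)[d]`
      refine le_trans hsq ?_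
      haveI : Finite (AddSubgroup.torsionBy (W.baseChange (κ.layer n)).toAffine.Point d) := by
        refine Finite.of_injective
          (fun x : AddSubgroup.torsionBy (W.baseChange (κ.layer n)).toAffine.Point d =>
            (⟨x.1, ?_⟩ : AddCommGroup.torsion (W.baseChange (κ.layer n)).toAffine.Point)) ?_
        · exact isOfFinAddOrder_iff_nsmul_eq_zero.mpr
            ⟨d, hd0, AddSubgroup.torsionBy.nsmul_iff.mp x.2⟩
        · intro x y hxy
          simp only [Subtype.mk.injEq] at hxy
          exact Subtype.ext hxy
      refine Nat.card_le_card_of_injective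
        (fun x : AddSubgroup.torsionBy
            (AddCommGroup.torsion (W.baseChange (κ.layer n)).toAffine.Point) d =>
          (⟨(x.1 : (W.baseChange (κ.layer n)).toAffine.Point), ?_⟩ :
            AddSubgroup.torsionBy (W.baseChange (κ.layer n)).toAffine.Point d)) ?_
      · rw [AddSubgroup.torsionBy.nsmul_iff]
        have h2 := congrArg Subtype.val (AddSubgroup.torsionBy.nsmul_iff.mp x.2)
        push_cast at h2
        exact h2
      · intro x y hxy
        simp only [Subtype.mk.injEq] at hxy
        exact Subtype.ext (Subtype.ext hxy)
  -- (I) `d ∣ w`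
  have hdw : d ∣ NumberField.Units.torsionOrder K := by
    rcases Nat.lt_or_ge d 2 with hd2 | hd2
    · have hd1 : d = 1 := by omega
      rw [hd1]; exact one_dvd _
    · have hdF : (d : κ.layer n) ≠ 0 := Nat.cast_ne_zero.mpr hd0.ne'
      obtain ⟨ζ, hζ⟩ :=
        (W.baseChange (κ.layer n)).exists_isPrimitiveRoot_of_card_torsionBy_eq_sq_holds d hd2 hdF
          hAd
      have hζ' : IsPrimitiveRoot (algebraMap (κ.layer n) (AlgebraicClosure K) ζ) d :=
        hζ.map_of_injective (algebraMap (κ.layer n) (AlgebraicClosure K)).injective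
      exact dvd_torsionOrder_of_isPrimitiveRoot_layer hK.1 hp κ hκ n hd0 ζ.2 hζ'
  -- (II) `e / d ≤ t`: the point `ι (d P)` generates a stable cyclic group defined over `K_n`
  have hPA : addOrderOf (P : (W.baseChange (κ.layer n)).toAffine.Point) = e := by
    rw [AddSubgroup.addOrderOf_coe]; exact hP
  have hQord : addOrderOf (ι (d • (P : (W.baseChange (κ.layer n)).toAffine.Point))) = e / d := by
    rw [addOrderOf_injective ι hι, addOrderOf_nsmul_of_dvd hd0.ne' (by rw [hPA]; exact hde), hPA]
  have hQfin : IsOfFinAddOrder (ι (d • (P : (W.baseChange (κ.layer n)).toAffine.Point))) :=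
    addOrderOf_pos_iff.mp (by rw [hQord]; exact Nat.div_pos (Nat.le_of_dvd he0 hde) hd0)
  have hQfix : ∀ σ ∈ κ.layerSubgroup n,
      WeierstrassCurve.Affine.Point.map (W' := W)
        (MulSemiringAction.toRingHom (absoluteGaloisGroup K) (AlgebraicClosure K) σ).toRatAlgHom
          (ι (d • (P : (W.baseChange (κ.layer n)).toAffine.Point))) =
        ι (d • (P : (W.baseChange (κ.layer n)).toAffine.Point)) := by
    intro σ hσ
    exact map_map_eq_of_forall_apply_eq W (κ.layer n) _
      (fun y => (mem_layer_iff κ n (y : AlgebraicClosure K)).mp y.2 σ hσ) _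
  have hQstab : ∀ φ : AlgebraicClosure K →+* AlgebraicClosure K,
      (∀ y ∈ κ.layer n, φ y ∈ κ.layer n) →
        WeierstrassCurve.Affine.Point.map (W' := W) φ.toRatAlgHom
          (ι (d • (P : (W.baseChange (κ.layer n)).toAffine.Point))) ∈
          AddSubgroup.zmultiples (ι (d • (P : (W.baseChange (κ.layer n)).toAffine.Point))) := by
    intro φ hφ
    obtain ⟨R', hR'⟩ :=
      exists_map_eq_map W (κ.layer n) φ hφ (P : (W.baseChange (κ.layer n)).toAffine.Point)
    have hR'ι : WeierstrassCurve.Affine.Point.map (W' := W) φ.toRatAlgHom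
        (ι (P : (W.baseChange (κ.layer n)).toAffine.Point)) = ι R' := hR'
    -- `R'` is torsion (`e R' = 0`)
    have hR'T : R' ∈ AddCommGroup.torsion (W.baseChange (κ.layer n)).toAffine.Point := by
      refine isOfFinAddOrder_iff_nsmul_eq_zero.mpr ⟨e, he0, hι ?_⟩
      rw [map_nsmul, ← hR'ι, ← map_nsmul, ← map_nsmul, hTe P, map_zero, map_zero]
    obtain ⟨k, hk⟩ := AddSubgroup.mem_zmultiples_iff.mp (hdT ⟨R', hR'T⟩)
    have hk' : k • (d • (P : (W.baseChange (κ.layer n)).toAffine.Point)) = d • R' := by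
      have := congrArg Subtype.val hk
      push_cast at this
      exact this
    have h1 : WeierstrassCurve.Affine.Point.map (W' := W) φ.toRatAlgHom
        (ι (d • (P : (W.baseChange (κ.layer n)).toAffine.Point))) = ι (d • R') := by
      rw [map_nsmul, map_nsmul, hR'ι, map_nsmul]
    refine AddSubgroup.mem_zmultiples_iff.mpr ⟨k, ?_⟩
    rw [h1, ← hk', map_zsmul]
  have hed : e / d ≤ Nat.card (AddCommGroup.torsion (W.baseChange K).toAffine.Point) := by
    have := addOrderOf_le_card_torsion_of_stable W hK.1 hp κ hκ n _ hQfin hQfix hQstab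
    rwa [hQord] at this
  -- conclusion: `#T = e d = (e/d) d d ≤ t w w`
  have hdw' : d ≤ NumberField.Units.torsionOrder K := Nat.le_of_dvd hw0 hdw
  calc Nat.card (AddCommGroup.torsion (W.baseChange (κ.layer n)).toAffine.Point)
      = e * d := hcardT
    _ = e / d * d * d := by rw [Nat.div_mul_cancel hde]
    _ ≤ Nat.card (AddCommGroup.torsion (W.baseChange K).toAffine.Point) *
          NumberField.Units.torsionOrder K * NumberField.Units.torsionOrder K :=
        Nat.mul_le_mul (Nat.mul_le_mul hed hdw') hdw'
    _ = NumberField.Units.torsionOrder K ^ 2 *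
          Nat.card (AddCommGroup.torsion (W.baseChange K).toAffine.Point) := by ring

/-- **Li–Xu 2026, Proposition 5.2 for an elliptic curve, PROVED**: the named fact
`prop52_torsionOrder_layer_bounded` — for `W/ℚ` elliptic, `K` imaginary quadratic, `p ≠ 2` and
`κ` an anticyclotomic `ℤ_p`-extension of `K`, the torsion orders `#E(K_n)_{tors}` of the layers are
bounded (by `w_K² · #E(K)_{tors}`). [cite: LiXu2026, Prop. 5.2 and Lemma 5.1 (arXiv:2502.12648)] -/
theorem prop52_torsionOrder_layer_bounded_holds : prop52_torsionOrder_layer_bounded := by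
  intro W _ K _ _ hK p _ hp κ hκ
  exact ⟨NumberField.Units.torsionOrder K ^ 2 * (W.baseChange K).torsionOrder,
    fun n => card_torsion_layer_le W hK hp κ hκ n⟩

end Main

end Literature.NumberTheory.EllipticCurves.LiXu2026

end
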